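import Literature.AnabelianGeometry.SemiGraphs.ProfiniteSemiGraphIsoTransportCasts
import Literature.AnabelianGeometry.SemiGraphs.ProfiniteIsoOverEquiv
import HarnessLib

/-!
# The inverse of an isomorphism of profinite presentations, with its 2-cells (route T, TRANSPORT IV)

Mochizuki, *Semi-graphs of anabelioids*, Publ. RIMS **42** (2006), §2 Def. 2.1 p. 22, Def. 2.2 (ii)
p. 24 (locally trivial morphisms), Rmk. 2.4.2 p. 26 (the compatibilities with the branch maps hold up to
conjugation — the 2-cells `φ_b` are data), §3 Prop. 3.6 (iv) p. 39 (pull-back of coverings)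
[cite: MochizukiSemiAnbd2006, Rmk 2.4.2 p.26].

For a morphism of profinite presentations `F : X → Y` (`ProfiniteSemiGraph.Hom`) whose underlying
morphism of semi-graphs is an isomorphism and whose constituent homomorphisms are bijective
(`Hom.IsLocallyTrivial`; the data of abc-iut-L3-t3's `Hom.IsoOver` with the base forgotten) this file
CONSTRUCTS the inverse morphism `F.inverse hlt : Y → X` (underlying semi-graph `inv F.base`,
constituents `F_v⁻¹`, `F_e⁻¹` transported along `F (F⁻¹ w) = w`; its 2-cells are read off from those of
`F`), and — the point of the file — for every family of 2-cells `θ` of `F` (`Hom.ConjugatorFamily`,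
abc-iut-L3-d4's `TemperedFunctorialityWith.lean`, cell finding RQ12: the pull-back functor DEPENDS on
the 2-cells, two admissible choices differing by a profinite Dehn twist) the INVERSE family
`F.inverseConjugators hlt θ` of 2-cells of `F.inverse hlt`, chosen so that the composite 2-cells of
`F⁻¹ ∘ F` and `F ∘ F⁻¹` are trivial (`hV_inverseθ_mul`, `inverseHV_θ_mul_inverseθ`).  With it the sequel
(`ProfiniteSemiGraphIsoPullbackEquivalence`) shows that `F.covPullbackWith θ` and
`(F.inverse hlt).covPullbackWith (F.inverseConjugators hlt θ)` are mutually inverse equivalences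
`B^cov(Y) ≌ B^cov(X)`, `B^temp(Y) ≌ B^temp(X)`.  abc-iut cell, L3 route T · TRANSPORT (seat
abc-iut-L3-d6); definitions + bookkeeping, nothing of the paper is asserted; nothing here bears on
[IUTchIII] Cor. 3.12.
-/

noncomputable section

open CategoryTheory Topology

namespace Literature.AnabelianGeometry.SemiGraphs

namespace ProfiniteSemiGraph

universe u

variable {X Y : ProfiniteSemiGraph.{u}}

/-! ### The constituent isomorphisms of a locally trivial morphism -/

namespace Hom

variable {F : Hom X Y} (hlt : F.IsLocallyTrivial)

/-- The constituent isomorphism of topological groups `Π_{X,v} ≃ Π_{Y,F v}` of a locally trivial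
morphism (it IS `F_v`: abc-iut-L3-t3's `exists_gvEquiv`, chosen). [cite: MochizukiSemiAnbd2006, Def 2.2(ii) p.24] -/
def IsLocallyTrivial.gvEquiv (v : X.graph.Vertex) : X.Gv v ≃ₜ* Y.Gv (F.base.vertexMap v) :=
  (hlt.exists_gvEquiv v).choose

/-- `gvEquiv` is `F_v`. [cite: MochizukiSemiAnbd2006, Def 2.2(ii) p.24] -/
@[simp] theorem IsLocallyTrivial.gvEquiv_apply (v : X.graph.Vertex) (x : X.Gv v) :
    hlt.gvEquiv v x = F.hV v x :=
  (hlt.exists_gvEquiv v).choose_spec x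

/-- The constituent isomorphism `Π_{X,e} ≃ Π_{Y,F e}` (it IS `F_e`). [cite: MochizukiSemiAnbd2006, Def 2.2(ii) p.24] -/
def IsLocallyTrivial.geEquiv (e : X.graph.Edge) : X.Ge e ≃ₜ* Y.Ge (F.base.edgeMap e) :=
  (hlt.exists_geEquiv e).choose

/-- `geEquiv` is `F_e`. [cite: MochizukiSemiAnbd2006, Def 2.2(ii) p.24] -/
@[simp] theorem IsLocallyTrivial.geEquiv_apply (e : X.graph.Edge) (x : X.Ge e) :
    hlt.geEquiv e x = F.hE e x :=
  (hlt.exists_geEquiv e).choose_spec x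

/-- `F_v (F_v⁻¹ y) = y`. [cite: MochizukiSemiAnbd2006, Def 2.2(ii) p.24] -/
@[simp] theorem IsLocallyTrivial.hV_gvEquiv_symm (v : X.graph.Vertex) (y : Y.Gv (F.base.vertexMap v)) :
    F.hV v ((hlt.gvEquiv v).symm y) = y := by
  rw [← hlt.gvEquiv_apply, ContinuousMulEquiv.apply_symm_apply]

/-- `F_v⁻¹ (F_v x) = x`. [cite: MochizukiSemiAnbd2006, Def 2.2(ii) p.24] -/
@[simp] theorem IsLocallyTrivial.gvEquiv_symm_hV (v : X.graph.Vertex) (x : X.Gv v) :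
    (hlt.gvEquiv v).symm (F.hV v x) = x := by
  rw [← hlt.gvEquiv_apply, ContinuousMulEquiv.symm_apply_apply]

/-- `F_e (F_e⁻¹ y) = y`. [cite: MochizukiSemiAnbd2006, Def 2.2(ii) p.24] -/
@[simp] theorem IsLocallyTrivial.hE_geEquiv_symm (e : X.graph.Edge) (y : Y.Ge (F.base.edgeMap e)) :
    F.hE e ((hlt.geEquiv e).symm y) = y := by
  rw [← hlt.geEquiv_apply, ContinuousMulEquiv.apply_symm_apply]

/-- `F_e⁻¹ (F_e x) = x`. [cite: MochizukiSemiAnbd2006, Def 2.2(ii) p.24] -/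
@[simp] theorem IsLocallyTrivial.geEquiv_symm_hE (e : X.graph.Edge) (x : X.Ge e) :
    (hlt.geEquiv e).symm (F.hE e x) = x := by
  rw [← hlt.geEquiv_apply, ContinuousMulEquiv.symm_apply_apply]

/-- `F_{v₀}⁻¹ ∘ transport ∘ F_v` is transport, for `v₀ = v` (`subst`-able form).
[cite: MochizukiSemiAnbd2006, Def 2.2(ii) p.24] -/
theorem IsLocallyTrivial.gvEquiv_symm_castGv_hV {v₀ v : X.graph.Vertex} (p : v₀ = v) (x : X.Gv v) :
    (hlt.gvEquiv v₀).symm (Y.castGv (congrArg F.base.vertexMap p).symm (F.hV v x)) =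
      X.castGv p.symm x := by
  subst p
  exact hlt.gvEquiv_symm_hV _ x

/-- `F_{e₀}⁻¹ ∘ transport ∘ F_e` is transport, for `e₀ = e` (`subst`-able form).
[cite: MochizukiSemiAnbd2006, Def 2.2(ii) p.24] -/
theorem IsLocallyTrivial.geEquiv_symm_castGe_hE {e₀ e : X.graph.Edge} (p : e₀ = e) (x : X.Ge e) :
    (hlt.geEquiv e₀).symm (Y.castGe (congrArg F.base.edgeMap p).symm (F.hE e x)) =
      X.castGe p.symm x := by
  subst p
  exact hlt.geEquiv_symm_hE _ x

end Hom

/-! ### The inverse morphism -/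

namespace Hom

variable (F : Hom X Y) (hlt : F.IsLocallyTrivial) [IsIso (C := SemiGraph.{u}) F.base]

/-- The vertex homomorphisms of the inverse: `Π_{Y,w} → Π_{Y,F(F⁻¹ w)} → Π_{X,F⁻¹ w}` (transport, then
`F_{F⁻¹ w}⁻¹`). [cite: MochizukiSemiAnbd2006, Def 2.2(ii) p.24] -/
def inverseHV (w : Y.graph.Vertex) : Y.Gv w →ₜ* X.Gv ((inv (C := SemiGraph.{u}) F.base).vertexMap w) :=
  ((hlt.gvEquiv ((inv (C := SemiGraph.{u}) F.base).vertexMap w)).symm :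
      Y.Gv (F.base.vertexMap ((inv (C := SemiGraph.{u}) F.base).vertexMap w)) →ₜ* X.Gv ((inv (C := SemiGraph.{u}) F.base).vertexMap w)).comp
    (Y.castGv (SemiGraph.vertexMap_inv_vertexMap F.base w).symm :
      Y.Gv w →ₜ* Y.Gv (F.base.vertexMap ((inv (C := SemiGraph.{u}) F.base).vertexMap w)))

/-- The edge homomorphisms of the inverse: `Π_{Y,e} → Π_{Y,F(F⁻¹ e)} → Π_{X,F⁻¹ e}`.
[cite: MochizukiSemiAnbd2006, Def 2.2(ii) p.24] -/
def inverseHE (e : Y.graph.Edge) : Y.Ge e →ₜ* X.Ge ((inv (C := SemiGraph.{u}) F.base).edgeMap e) :=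
  ((hlt.geEquiv ((inv (C := SemiGraph.{u}) F.base).edgeMap e)).symm :
      Y.Ge (F.base.edgeMap ((inv (C := SemiGraph.{u}) F.base).edgeMap e)) →ₜ* X.Ge ((inv (C := SemiGraph.{u}) F.base).edgeMap e)).comp
    (Y.castGe (SemiGraph.edgeMap_inv_edgeMap F.base e).symm :
      Y.Ge e →ₜ* Y.Ge (F.base.edgeMap ((inv (C := SemiGraph.{u}) F.base).edgeMap e)))

/-- Unfolding `inverseHV`. [cite: MochizukiSemiAnbd2006, Def 2.2(ii) p.24] -/
theorem inverseHV_apply (w : Y.graph.Vertex) (y : Y.Gv w) :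
    F.inverseHV hlt w y = (hlt.gvEquiv ((inv (C := SemiGraph.{u}) F.base).vertexMap w)).symm
      (Y.castGv (SemiGraph.vertexMap_inv_vertexMap F.base w).symm y) := rfl

/-- Unfolding `inverseHE`. [cite: MochizukiSemiAnbd2006, Def 2.2(ii) p.24] -/
theorem inverseHE_apply (e : Y.graph.Edge) (y : Y.Ge e) :
    F.inverseHE hlt e y = (hlt.geEquiv ((inv (C := SemiGraph.{u}) F.base).edgeMap e)).symm
      (Y.castGe (SemiGraph.edgeMap_inv_edgeMap F.base e).symm y) := rfl

/-- `F_{F⁻¹ w} ∘ (F⁻¹)_w` is the transport `Π_{Y,w} → Π_{Y,F(F⁻¹ w)}`. [cite: MochizukiSemiAnbd2006, Def 2.2(ii) p.24] -/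
@[simp] theorem hV_inverseHV (w : Y.graph.Vertex) (y : Y.Gv w) :
    F.hV ((inv (C := SemiGraph.{u}) F.base).vertexMap w) (F.inverseHV hlt w y) =
      Y.castGv (SemiGraph.vertexMap_inv_vertexMap F.base w).symm y := by
  rw [inverseHV_apply, hlt.hV_gvEquiv_symm]

/-- `F_{F⁻¹ e} ∘ (F⁻¹)_e` is the transport `Π_{Y,e} → Π_{Y,F(F⁻¹ e)}`. [cite: MochizukiSemiAnbd2006, Def 2.2(ii) p.24] -/
@[simp] theorem hE_inverseHE (e : Y.graph.Edge) (y : Y.Ge e) :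
    F.hE ((inv (C := SemiGraph.{u}) F.base).edgeMap e) (F.inverseHE hlt e y) =
      Y.castGe (SemiGraph.edgeMap_inv_edgeMap F.base e).symm y := by
  rw [inverseHE_apply, hlt.hE_geEquiv_symm]

/-- `(F⁻¹)_w (transport (F_{F⁻¹ w} x)) = x`. [cite: MochizukiSemiAnbd2006, Def 2.2(ii) p.24] -/
@[simp] theorem inverseHV_castGv_hV (w : Y.graph.Vertex) (x : X.Gv ((inv (C := SemiGraph.{u}) F.base).vertexMap w)) :
    F.inverseHV hlt w (Y.castGv (SemiGraph.vertexMap_inv_vertexMap F.base w) (F.hV _ x)) = x := by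
  rw [inverseHV_apply, castGv_castGv]
  exact hlt.gvEquiv_symm_hV _ x

/-- `(F⁻¹)_e (transport (F_{F⁻¹ e} x)) = x`. [cite: MochizukiSemiAnbd2006, Def 2.2(ii) p.24] -/
@[simp] theorem inverseHE_castGe_hE (e : Y.graph.Edge) (x : X.Ge ((inv (C := SemiGraph.{u}) F.base).edgeMap e)) :
    F.inverseHE hlt e (Y.castGe (SemiGraph.edgeMap_inv_edgeMap F.base e) (F.hE _ x)) = x := by
  rw [inverseHE_apply, castGe_castGe]
  exact hlt.geEquiv_symm_hE _ x

/-- `(F⁻¹)_{F v} ∘ F_v` is the transport `Π_{X,v} → Π_{X,F⁻¹(F v)}`. [cite: MochizukiSemiAnbd2006, Def 2.2(ii) p.24] -/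
@[simp] theorem inverseHV_hV (v : X.graph.Vertex) (x : X.Gv v) :
    F.inverseHV hlt (F.base.vertexMap v) (F.hV v x) =
      X.castGv (SemiGraph.inv_vertexMap_vertexMap F.base v).symm x :=
  hlt.gvEquiv_symm_castGv_hV (SemiGraph.inv_vertexMap_vertexMap F.base v) x

/-- `(F⁻¹)_{F e} ∘ F_e` is the transport `Π_{X,e} → Π_{X,F⁻¹(F e)}`. [cite: MochizukiSemiAnbd2006, Def 2.2(ii) p.24] -/
@[simp] theorem inverseHE_hE (e : X.graph.Edge) (x : X.Ge e) :
    F.inverseHE hlt (F.base.edgeMap e) (F.hE e x) =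
      X.castGe (SemiGraph.inv_edgeMap_edgeMap F.base e).symm x :=
  hlt.geEquiv_symm_castGe_hE (SemiGraph.inv_edgeMap_edgeMap F.base e) x

/-- The constituents of the inverse are bijective. [cite: MochizukiSemiAnbd2006, Def 2.2(ii) p.24] -/
theorem inverseHV_bijective (w : Y.graph.Vertex) : Function.Bijective (F.inverseHV hlt w) :=
  (hlt.gvEquiv ((inv (C := SemiGraph.{u}) F.base).vertexMap w)).symm.bijective.comp (Y.castGv _).bijective

/-- The constituents of the inverse are bijective. [cite: MochizukiSemiAnbd2006, Def 2.2(ii) p.24] -/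
theorem inverseHE_bijective (e : Y.graph.Edge) : Function.Bijective (F.inverseHE hlt e) :=
  (hlt.geEquiv ((inv (C := SemiGraph.{u}) F.base).edgeMap e)).symm.bijective.comp (Y.castGe _).bijective

/-! ### The 2-cells of the inverse -/

variable (θ : F.ConjugatorFamily)

/-- The INVERSE 2-cell at a branch `b` of `Y` abutting to `w`: `(F⁻¹)_w` of the inverse of the 2-cell
`θ_{F⁻¹ b}` of `F`, transported into `Π_{Y,w}`. [cite: MochizukiSemiAnbd2006, Rmk 2.4.2 p.26] -/
def inverseθ (b : Y.graph.Branch) (w : Y.graph.Vertex) (h : Y.graph.abuts b = some w) :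
    X.Gv ((inv (C := SemiGraph.{u}) F.base).vertexMap w) :=
  F.inverseHV hlt w (Y.castGv (SemiGraph.vertexMap_inv_vertexMap F.base w)
    (θ.θ ((inv (C := SemiGraph.{u}) F.base).branchMap b) ((inv (C := SemiGraph.{u}) F.base).vertexMap w) ((inv (C := SemiGraph.{u}) F.base).abuts_branchMap b w h)))⁻¹

/-- `F_{F⁻¹ w}` of the inverse 2-cell, times the 2-cell of `F` at `F⁻¹ b`, is trivial (transported).
[cite: MochizukiSemiAnbd2006, Rmk 2.4.2 p.26] -/
theorem hV_inverseθ (b : Y.graph.Branch) (w : Y.graph.Vertex) (h : Y.graph.abuts b = some w) :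
    F.hV _ (F.inverseθ hlt θ b w h) = (Y.castGv (SemiGraph.vertexMap_inv_vertexMap F.base w).symm
      (Y.castGv (SemiGraph.vertexMap_inv_vertexMap F.base w)
        (θ.θ ((inv (C := SemiGraph.{u}) F.base).branchMap b) ((inv (C := SemiGraph.{u}) F.base).vertexMap w) ((inv (C := SemiGraph.{u}) F.base).abuts_branchMap b w h))))⁻¹ := by
  simp only [inverseθ, map_inv, hV_inverseHV]

/-- The composite 2-cell of `F ∘ F⁻¹` at a branch of `Y` is trivial:
`F_{F⁻¹ w}((F⁻¹-2-cell)_b) · θ_{F⁻¹ b} = 1`. [cite: MochizukiSemiAnbd2006, Rmk 2.4.2 p.26] -/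
theorem hV_inverseθ_mul (b : Y.graph.Branch) (w : Y.graph.Vertex) (h : Y.graph.abuts b = some w) :
    F.hV _ (F.inverseθ hlt θ b w h) *
      θ.θ ((inv (C := SemiGraph.{u}) F.base).branchMap b) ((inv (C := SemiGraph.{u}) F.base).vertexMap w) ((inv (C := SemiGraph.{u}) F.base).abuts_branchMap b w h) = 1 := by
  rw [hV_inverseθ, castGv_castGv]
  exact inv_mul_cancel _

/-- The composite 2-cell of `F⁻¹ ∘ F` at a branch `b'` of `X` abutting to `v'` is trivial:
`(F⁻¹)_{F v'}(θ_{b'}) · (F⁻¹-2-cell)_{F b'} = 1`. [cite: MochizukiSemiAnbd2006, Rmk 2.4.2 p.26] -/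
theorem inverseHV_θ_mul_inverseθ (b' : X.graph.Branch) (v' : X.graph.Vertex)
    (h' : X.graph.abuts b' = some v') (h : Y.graph.abuts (F.base.branchMap b') = some (F.base.vertexMap v')) :
    F.inverseHV hlt (F.base.vertexMap v') (θ.θ b' v' h') *
      F.inverseθ hlt θ (F.base.branchMap b') (F.base.vertexMap v') h = 1 := by
  rw [inverseθ, ← map_mul, θ.castGv_θ (SemiGraph.inv_branchMap_branchMap F.base b')
    (SemiGraph.inv_vertexMap_vertexMap F.base v') _ h', mul_inv_cancel, map_one]

/-- **The key square for the inverse**: `(F⁻¹)_w ∘ b_* = γ_{inverse 2-cell} ∘ (F⁻¹ b)_* ∘ (F⁻¹)_e`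
(edge group of `X` re-indexed along `F⁻¹ (edgeOf b) = edgeOf (F⁻¹ b)`).
[cite: MochizukiSemiAnbd2006, Rmk 2.4.2 p.26] -/
theorem inverseHV_brHom (b : Y.graph.Branch) (w : Y.graph.Vertex) (h : Y.graph.abuts b = some w)
    (y : Y.Ge (Y.graph.edgeOf b)) :
    F.inverseHV hlt w (Y.brHom b w h y) =
      F.inverseθ hlt θ b w h *
        X.brHom ((inv (C := SemiGraph.{u}) F.base).branchMap b) ((inv (C := SemiGraph.{u}) F.base).vertexMap w)
          ((inv (C := SemiGraph.{u}) F.base).abuts_branchMap b w h)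
          (X.castGe ((inv (C := SemiGraph.{u}) F.base).edgeOf_branchMap b).symm
            (F.inverseHE hlt (Y.graph.edgeOf b) y)) *
        (F.inverseθ hlt θ b w h)⁻¹ := by
  -- `F_e` of the re-indexed `(F⁻¹)_e y` is `y`, transported
  have hy : Y.castGe ((F.base.edgeOf_branchMap ((inv (C := SemiGraph.{u}) F.base).branchMap b)).symm.trans
      (congrArg Y.graph.edgeOf (SemiGraph.branchMap_inv_branchMap F.base b)))
      (F.hE _ (X.castGe ((inv (C := SemiGraph.{u}) F.base).edgeOf_branchMap b).symm
        (F.inverseHE hlt (Y.graph.edgeOf b) y))) = y := by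
    rw [hE_castGe, hE_inverseHE, castGe_castGe, castGe_castGe]
    exact castGe_rfl Y _ y
  -- the square of `F` at `F⁻¹ b`, transported to `w`
  have hc := θ.comm_cast ((inv (C := SemiGraph.{u}) F.base).branchMap b)
    ((inv (C := SemiGraph.{u}) F.base).vertexMap w) ((inv (C := SemiGraph.{u}) F.base).abuts_branchMap b w h)
    (SemiGraph.branchMap_inv_branchMap F.base b) (SemiGraph.vertexMap_inv_vertexMap F.base w) h
    (X.castGe ((inv (C := SemiGraph.{u}) F.base).edgeOf_branchMap b).symm (F.inverseHE hlt (Y.graph.edgeOf b) y))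
  rw [hy] at hc
  have hc' : Y.brHom b w h y =
      (Y.castGv (SemiGraph.vertexMap_inv_vertexMap F.base w) (θ.θ ((inv (C := SemiGraph.{u}) F.base).branchMap b)
        ((inv (C := SemiGraph.{u}) F.base).vertexMap w) ((inv (C := SemiGraph.{u}) F.base).abuts_branchMap b w h)))⁻¹ *
      Y.castGv (SemiGraph.vertexMap_inv_vertexMap F.base w) (F.hV _
        (X.brHom ((inv (C := SemiGraph.{u}) F.base).branchMap b) ((inv (C := SemiGraph.{u}) F.base).vertexMap w)
          ((inv (C := SemiGraph.{u}) F.base).abuts_branchMap b w h)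
          (X.castGe ((inv (C := SemiGraph.{u}) F.base).edgeOf_branchMap b).symm
            (F.inverseHE hlt (Y.graph.edgeOf b) y)))) *
      Y.castGv (SemiGraph.vertexMap_inv_vertexMap F.base w) (θ.θ ((inv (C := SemiGraph.{u}) F.base).branchMap b)
        ((inv (C := SemiGraph.{u}) F.base).vertexMap w) ((inv (C := SemiGraph.{u}) F.base).abuts_branchMap b w h)) := by
    rw [hc]; group
  rw [hc', map_mul, map_mul, inverseHV_castGv_hV, inverseθ, map_inv, inv_inv]

/-- **The inverse morphism** `F⁻¹ : Y → X` of an isomorphism of profinite presentations (base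
`inv F.base`, constituents `F_v⁻¹`, `F_e⁻¹` transported, 2-cells from those of `F`).
[cite: MochizukiSemiAnbd2006, Def 2.2(ii) p.24] -/
abbrev inverse : Hom Y X where
  base := inv (C := SemiGraph.{u}) F.base
  hV := F.inverseHV hlt
  hE := F.inverseHE hlt
  comm b w h := ⟨F.inverseθ hlt F.chosenConjugators b w h, fun y => by
    rw [F.inverseHV_brHom hlt F.chosenConjugators b w h y,
      eqRec_eq_castGe ((inv (C := SemiGraph.{u}) F.base).edgeOf_branchMap b)]⟩

/-- The underlying morphism of semi-graphs of the inverse (definitional). [cite: MochizukiSemiAnbd2006, §1 p.11] -/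
theorem inverse_base : (F.inverse hlt).base = inv (C := SemiGraph.{u}) F.base := rfl

/-- The vertex homomorphisms of the inverse (definitional). [cite: MochizukiSemiAnbd2006, Def 2.2(ii) p.24] -/
theorem inverse_hV (w : Y.graph.Vertex) : (F.inverse hlt).hV w = F.inverseHV hlt w := rfl

/-- The edge homomorphisms of the inverse (definitional). [cite: MochizukiSemiAnbd2006, Def 2.2(ii) p.24] -/
theorem inverse_hE (e : Y.graph.Edge) : (F.inverse hlt).hE e = F.inverseHE hlt e := rfl

/-- The underlying morphism of semi-graphs of the inverse is an isomorphism. [cite: MochizukiSemiAnbd2006, §1 p.11] -/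
instance isIso_inverse_base : IsIso (C := SemiGraph.{u}) (F.inverse hlt).base := by
  change IsIso (inv (C := SemiGraph.{u}) F.base); infer_instance

/-- The inverse is locally trivial. [cite: MochizukiSemiAnbd2006, Def 2.2(ii) p.24] -/
theorem inverse_isLocallyTrivial : (F.inverse hlt).IsLocallyTrivial :=
  ⟨F.inverseHV_bijective hlt, F.inverseHE_bijective hlt⟩

/-- **The inverse family of 2-cells** of `F⁻¹` attached to a family `θ` of 2-cells of `F`.
[cite: MochizukiSemiAnbd2006, Rmk 2.4.2 p.26] -/
def inverseConjugators : (F.inverse hlt).ConjugatorFamily where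
  θ := F.inverseθ hlt θ
  spec b w h y := by
    change F.inverseθ hlt θ b w h * X.brHomAt ((inv (C := SemiGraph.{u}) F.base).branchMap b) ((inv (C := SemiGraph.{u}) F.base).vertexMap w)
        ((inv (C := SemiGraph.{u}) F.base).abuts_branchMap b w h) _ ((inv (C := SemiGraph.{u}) F.base).edgeOf_branchMap b)
        (F.inverseHE hlt (Y.graph.edgeOf b) y) * (F.inverseθ hlt θ b w h)⁻¹ =
      F.inverseHV hlt w (Y.brHom b w h y)
    rw [brHomAt_apply, eqRec_eq_castGe ((inv (C := SemiGraph.{u}) F.base).edgeOf_branchMap b),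
      F.inverseHV_brHom hlt θ b w h y]

/-- The inverse 2-cells (definitional). [cite: MochizukiSemiAnbd2006, Rmk 2.4.2 p.26] -/
@[simp] theorem inverseConjugators_θ (b : Y.graph.Branch) (w : Y.graph.Vertex)
    (h : Y.graph.abuts b = some w) : (F.inverseConjugators hlt θ).θ b w h = F.inverseθ hlt θ b w h := rfl

end Hom

end ProfiniteSemiGraph

end Literature.AnabelianGeometry.SemiGraphs

end
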